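import Summits.BirchSwinnertonDyer.Rank1Residual.Additive.PotSupersingularClasses
import Summits.BirchSwinnertonDyer.Rank1Residual.Additive.QuadraticTwistBSDComparisonIsogeny
import Summits.BirchSwinnertonDyer.Rank1Residual.X11b.ChaPairsMinimality
import Summits.BirchSwinnertonDyer.Rank1Residual.X11b.KrausMinimalityGeneralTwo
import Literature.NumberTheory.EllipticCurves.BSDRootNumber
import Literature.NumberTheory.EllipticCurves.BSDRootNumberSmallConductorProofs
import HarnessLib

/-!
# Route `KatoDescentPotSupersingular` (rung K9, cell `bsd-potss`): the `ℤ/9` CLASSES of the crux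
# `WildUpperReducibleDefect` (item stmt-BirchSwinnertonDyer-19190, registered stub `stub_red_nineTorsionMember`)
# — the stub's whole census scope, PER CLASS in the kernel: `54b`, `1890r` by Creutz–Miller (bsd.S31),
# `122094bl` by ONE `3`-descent certificate line; and the stub BY NAME restricted to those classes
# (a `--supports 19190 --as helper` file; seat `bsd-potss-k9-red9` g2; nothing booked, BSD is not proved
# by any of this, item 19190 is NOT closed by this file)

WHERE THIS SITS.  The crux U₀-red `WildUpperReducibleDefect` (upper half `MissingUpperBoundAt W 3` on the
wild-`3`, `r_an = 0`, `E[3]`-REDUCIBLE rows with «a `ℤ/9`-member in the class ∨ odd `ord₃ #Ш_an`») is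
SETTLED-BY-CITATION since the K9 rev-15 split (glue 19711 over the reviewed count fact
`Kato2004.exists_memberHullCountInputs`).  This seat's g0 file (`…WildUpperReducibleDefectStubs.lean`,
p459279, `wildUpperReducibleDefect_of_katoMember_of_stubNine_of_oddTorsionRows`) showed that with only the
route's M-level trust (crux M `ReducibleKatoMember`, torsion slack `t(W_K)`) + `PublishedInputsO6` the count
fact is needed on exactly two row sets: (i) `Sig.stub_red_nineTorsionMember` verbatim — the classes with a
`ℤ/9` member — and (ii) the odd-parity rows on `3`-torsion classes (EMPTY if BSD₃ holds; census `0`).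
Census of (i) (o6-r1 GEN 21 C-X3K-0, `gen21/census_x3k.tsv`, `N < 5·10⁵`): EXACTLY `3` of the `9 476`
X3 ∧ O6 ∧ r0 classes carry a `ℤ/9` member — `54b`, `1890r`, `122094bl` (all `v₃(N) = 3`, isogeny graph
`W₉ —3— W₃ —3— W₁`, `W₉ —9— W₁`; torsion `t = 2, 1, 0`; `#Ш_an = 1, 1, 1` except `#Ш_an(1890r2) =
#Ш_an(122094bl2) = 9`).  THIS FILE puts those three classes in the kernel, per class and modulo NAMED
PUBLISHED facts only — no count fact, no crux M:

* §1 SHAPES (route-free).  `missingPPartAt_of_isIsogenous_of_conductor_lt`: for a globally minimal `W₀` of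
  analytic rank `≤ 1` and conductor `N < 5000`, Creutz–Miller's theorem (bsd.S31,
  `bsdTriple_of_rank_le_one_of_conductor_lt`: full BSD, computer-assisted in print) gives `BSD(W₀,p)` at
  EVERY prime, hence Miller's missing `p`-part `MissingPPartAt W₀ p`, and Cassels' isogeny invariance
  (`bsdRHS_eq_of_isIsogenous`) + GZK + modularity carry it to every globally minimal `W ∼_ℚ W₀`
  (`TwistComparison.missing{Lower,Upper}BoundAt_of_isIsogenous`).
  `missingPPartAt_of_isIsogenous_of_card_primaryComponent_eq_one`: for `W₀` of analytic rank `≤ 1` with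
  `#Ш_an(W₀) = s`, `ord_p s = 0` and a CERTIFICATE `#Ш(W₀)[p^∞] = 1`, the same conclusion.
* §2 RECORDS.  `54b` (`W₀ = 54b1 = [1,-1,1,1,-1]`, `N = 54`), `1890r` (`W₀ = 1890r1 = [1,-1,1,-24407,-1468369]`,
  `N = 1890`): `MissingPPartAt W p` for every `p` at every member, from bsd.S31 — binders `hr`
  (`r_an(W₀) = 0`, Cremona `allbsd`) and `hN` (`N_{W₀} < 5000`, Cremona's label); `122094bl`
  (`W₀ = 122094bl1 = [1,-1,1,-5862644,-3527169193]`, `N = 122094 = 2·3³·7·17·19`): `MissingPPartAt W 3` at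
  every member from binders `hr`, `hs` (`#Ш_an(W₀) = 1`) and the certificate `hSha : #Ш(W₀)[3^∞] = 1`, whose
  EVIDENCE is kit j256899 (already item evidence on 19190; seat k9-red9 g0; engine `iso3kum.gp` sha256
  a8402cb1… = b2b-bsdres-sha-2 ENGINE 2, UNMODIFIED; explicit `3`-isogeny descent with Schaefer–Stoll local
  images, `K(S,3)` by `bnfinit` + `bnfcertify = 1`): row `122094bl1`, isogeny `x₀ = -2862`, `d = -3` to
  `122094bl3`: `dim Sel^{φ̂}(Ê) = 0`, `dim Sel^{φ}(E) = 1`, MW part `m = 1`, EXCESS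
  `= dim Ш(Ê)[φ̂] + dim Ш(E)[φ] = 0 ⟹ Ш(E)[3] = 0` (and the second isogeny `x₀ = 3997`, `d = 1` to
  `122094bl2`: `(ŝ, s_φ, m) = (3, 0, 1)`, excess `2` on the `Ê` side only, `dim Ш(E)[φ] = 0` again).
  DECIDED IN THE KERNEL for each `W₀`: `Δ ≠ 0` and global minimality (support of `Δ`, Silverman's
  `q¹² ∤ Δ` at every bad prime: `X11b.isGloballyMinimal_of_krausCriterion_support`).
* §3 THE STUB BY NAME ON ITS CENSUS CLASSES.  `stub_red_nineTorsionMember_onCensusClasses`: the conclusion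
  of `Sig.stub_red_nineTorsionMember` for every row `W` of the stub that is `ℚ`-isogenous to `54b1`, `1890r1`
  or `122094bl1` — below {bsd.S31, Cassels, GZK, modularity} and the §2 binders.  The extra hypothesis «`W`
  lies in one of the three classes» IS the census statement (complete for `N < 5·10⁵` by C-X3K-0); beyond
  the census the stub is the count fact's road (§2 of the g0 file) — nothing here is class-wide.

HONEST FRAMING.  Per-class records; the ONLY inputs are named published facts (bsd.S31 is a
computer-assisted theorem in print: Creutz–Miller 2012 Thm. 1.1 completing Miller 2011 / Miller–Stoll 2013,
repaired by Lawson–Wuthrich 2016) and displayed per-class data/certificate binders; typed ≠ proved ≠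
endorsed; the item stays OPEN/settled-by-citation exactly as before; no census number is an input to any
theorem; BSD is not advanced.  THEOREMS ONLY (no definition, no new fact, no `sorry`).

References: [CreutzMiller2012] Thm. 1.1; [Miller2011LMS] §1, Def. 1.1, Thm. 1.2; [LawsonWuthrich2016] §5;
[Cassels1965ArithmeticVIII]; [SilvermanAEC2009] VII.1 Rem. 1.1, Thm. X.4.14; [SchaeferStoll2004];
[Cremona2006] Table 1 (labels 54b, 1890r, 122094bl); [Kato2004Asterisque] Prop. 14.16 (context only).
-/

set_option autoImplicit false
-- sibling precedent (`KatoDescentPotSupersingularAssembly.lean`): the directory name repeats the summit name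
set_option linter.dupNamespace false

noncomputable section

open scoped Classical

namespace Summit.BirchSwinnertonDyer.BirchSwinnertonDyer.Theorems.WildUpperReducibleNineTorsionClasses

open WeierstrassCurve Literature.NumberTheory.EllipticCurves
  Literature.NumberTheory.EllipticCurves.Rank1Residual
  Literature.NumberTheory.EllipticCurves.Rank1Residual.Typed
  Literature.NumberTheory.EllipticCurves.Rank1Residual.X11RankOneCertificates
  Summit.BirchSwinnertonDyer.Rank1Residual
  Summit.BirchSwinnertonDyer.Rank1Residual.Additive

/-! ## §1 Shapes (route-free) -/

/-- **`MissingPPartAt` along the class of a SMALL-CONDUCTOR curve, every prime.** For `W₀/ℚ` globally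
minimal of analytic rank `≤ 1` (`hr₀`) and conductor `N_{W₀} < 5000` (`hN`): Creutz–Miller (bsd.S31, `hS31`:
rank `≤ 1` via GZK `hGZK`) gives RANK ∧ SHAFIN ∧ LEAD for `W₀`, hence `BSD(W₀,p)` for every prime `p`
(`forall_bsdp_of_bsdTriple`, `∏ c_ℓ > 0` discharged) and Miller's `p`-part `MissingPPartAt W₀ p`; Cassels'
isogeny invariance (`hCassels`) with GZK and modularity (`hmod`) transports both typed halves to every
globally minimal `W ∼_ℚ W₀`. Conditional on the four named facts; per class; nothing booked.
[cite: CreutzMiller2012, Thm 1.1 and the remark following it] [cite: Miller2011LMS, §1 and Def. 1.1]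
[cite: Cassels1965ArithmeticVIII] -/
theorem missingPPartAt_of_isIsogenous_of_conductor_lt (hS31 : bsdTriple_of_rank_le_one_of_conductor_lt)
    (hCassels : bsdRHS_eq_of_isIsogenous) (hGZK : rank_eq_analyticRank_of_analyticRank_le_one)
    (hmod : hasEntireLFunction_rat) (W₀ : WeierstrassCurve ℚ) [W₀.IsElliptic] [W₀.IsGloballyMinimal]
    (hr₀ : W₀.analyticRank ≤ 1) (hN : W₀.conductorNorm ℤ < 5000) (p : ℕ) [Fact p.Prime]
    (W : WeierstrassCurve ℚ) [W.IsElliptic] [W.IsGloballyMinimal] (hiso : IsIsogenous W W₀) :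
    MissingPPartAt W p := by
  obtain ⟨hrank, hfin⟩ := hGZK W₀ hr₀
  haveI : Finite W₀.sha := hfin
  have hBSD : W₀.BSDTriple := hS31 W₀ (by rw [hrank]; exact hr₀) hN
  have h₀ : MissingPPartAt W₀ p :=
    missingPPartAt_of_bsdp W₀ p (forall_bsdp_of_bsdTriple W₀ W₀.tamagawaProduct_pos_holds hBSD p Fact.out)
  obtain ⟨hl, hu⟩ := lower_and_upper_of_missingPPartAt W₀ p h₀
  exact missingPPartAt_of_lower_of_upper W p
    (TwistComparison.missingLowerBoundAt_of_isIsogenous W₀ W p hCassels hGZK hmod hiso.symm_of_charZero hr₀ hl)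
    (TwistComparison.missingUpperBoundAt_of_isIsogenous W₀ W p hCassels hGZK hmod hiso.symm_of_charZero hr₀ hu)

/-- **`MissingPPartAt` along the class of a curve with a `Ш[p^∞]`-CERTIFICATE.** For `W₀/ℚ` globally
minimal of analytic rank `≤ 1` (`hr₀`; so `Ш(W₀)` is finite by GZK) with `#Ш_an(W₀) = s`, `ord_p s = 0`
(`hs`, `hv`) and `#Ш(W₀)[p^∞] = 1` (`hSha`, the certificate binder): `ord_p #Ш(W₀) = 0 = ord_p #Ш_an(W₀)`,
i.e. `MissingPPartAt W₀ p`, transported to every globally minimal `W ∼_ℚ W₀` by Cassels (`hCassels`) + GZK +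
modularity (`hmod`). Conditional; per class; nothing booked.
[cite: Miller2011LMS, §1 and Def. 1.1] [cite: Cassels1965ArithmeticVIII] -/
theorem missingPPartAt_of_isIsogenous_of_card_primaryComponent_eq_one
    (hCassels : bsdRHS_eq_of_isIsogenous) (hGZK : rank_eq_analyticRank_of_analyticRank_le_one)
    (hmod : hasEntireLFunction_rat) (W₀ : WeierstrassCurve ℚ) [W₀.IsElliptic] [W₀.IsGloballyMinimal]
    (hr₀ : W₀.analyticRank ≤ 1) (p : ℕ) [Fact p.Prime] {s : ℚ} (hs : shaAn W₀ = (s : ℂ))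
    (hv : padicValRat p s = 0) (hSha : Nat.card (AddCommGroup.primaryComponent W₀.sha p) = 1)
    (W : WeierstrassCurve ℚ) [W.IsElliptic] [W.IsGloballyMinimal] (hiso : IsIsogenous W W₀) :
    MissingPPartAt W p := by
  haveI : Finite W₀.sha := (hGZK W₀ hr₀).2
  have h₀ : MissingPPartAt W₀ p := by
    refine ⟨s, hs, ?_⟩
    rw [hv, WeierstrassCurve.shaOrder, ← padicValNat_card_addPrimaryComponent (A := W₀.sha) p, hSha,
      padicValNat_one_right]
    rfl
  obtain ⟨hl, hu⟩ := lower_and_upper_of_missingPPartAt W₀ p h₀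
  exact missingPPartAt_of_lower_of_upper W p
    (TwistComparison.missingLowerBoundAt_of_isIsogenous W₀ W p hCassels hGZK hmod hiso.symm_of_charZero hr₀ hl)
    (TwistComparison.missingUpperBoundAt_of_isIsogenous W₀ W p hCassels hGZK hmod hiso.symm_of_charZero hr₀ hu)

/-! ## §2 Records: the three `ℤ/9` classes of the census -/

/-- `Δ(54b1) = -216 ≠ 0`: Cremona's model `54b1 = [1, -1, 1, 1, -1]` is an elliptic curve. [folklore] -/
theorem isElliptic_54b1 : (⟨1, -1, 1, 1, -1⟩ : WeierstrassCurve ℚ).IsElliptic :=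
  X11b.isElliptic_of_discOf_ne_zero 1 (-1) 1 1 (-1) (by decide +kernel)

/-- **`54b1 = [1, -1, 1, 1, -1]` is globally minimal** (`|Δ| = 216 = 2³·3³`; Silverman's `q¹² ∤ Δ` at
`q = 2, 3`). [cite: SilvermanAEC2009, VII.1 Remark 1.1] -/
theorem isGloballyMinimal_54b1 : (⟨1, -1, 1, 1, -1⟩ : WeierstrassCurve ℚ).IsGloballyMinimal :=
  X11b.isGloballyMinimal_of_krausCriterion_support 1 (-1) 1 1 (-1) [(2, 1, 3), (3, 3, 3)]
    (by intro t ht; simp only [List.mem_cons, List.not_mem_nil, or_false] at ht; rcases ht with rfl | rfl <;> norm_num)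
    (by decide +kernel) (by decide +kernel)

/-- **RECORD `54b` — `MissingPPartAt W p` for EVERY prime `p` at EVERY globally minimal member of the
class of `54b1 = [1, -1, 1, 1, -1]`** (`N = 54 = 2·3³`; Cremona: class `54b` = {54b1 `#tors = 3`, 54b2
`#tors = 1`, 54b3 `#tors = 9`}, all `r_an = 0`, `#Ш_an = 1`; the `ℤ/9` class of smallest conductor; X3 ∧ O6:
additive at `3` with `v₃(N) = 3`, `E[3]` reducible). From bsd.S31 (`hS31`, `N < 5000`) + Cassels + GZK +
modularity via §1; binders `hr` (`r_an(54b1) = 0`, Cremona `allbsd`), `hN` (`N_{54b1} < 5000`), `hiso` (the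
Cremona class datum). In particular the UPPER half at `p = 3` on every row of `stub_red_nineTorsionMember`
in this class. Per class; nothing booked. [cite: CreutzMiller2012, Thm 1.1] [cite: Miller2011LMS, §1 and Def. 1.1]
[cite: Cremona2006, Table 1 (Cremona label 54b1)] -/
theorem missingPPart_class54b (hS31 : bsdTriple_of_rank_le_one_of_conductor_lt)
    (hCassels : bsdRHS_eq_of_isIsogenous) (hGZK : rank_eq_analyticRank_of_analyticRank_le_one)
    (hmod : hasEntireLFunction_rat) (W₀ : WeierstrassCurve ℚ) (hW₀ : W₀ = ⟨1, -1, 1, 1, -1⟩)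
    (hr : W₀.analyticRank = 0) (hN : W₀.conductorNorm ℤ < 5000) (p : ℕ) [Fact p.Prime]
    (W : WeierstrassCurve ℚ) [W.IsElliptic] [W.IsGloballyMinimal] (hiso : IsIsogenous W W₀) :
    MissingPPartAt W p := by
  subst hW₀
  haveI := isElliptic_54b1
  haveI := isGloballyMinimal_54b1
  exact missingPPartAt_of_isIsogenous_of_conductor_lt hS31 hCassels hGZK hmod _ (by rw [hr]; exact zero_le_one)
    hN p W hiso

/-- `Δ(1890r1) = -8716379112000 ≠ 0`: Cremona's model `1890r1 = [1, -1, 1, -24407, -1468369]` is an elliptic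
curve. [folklore] -/
theorem isElliptic_1890r1 : (⟨1, -1, 1, -24407, -1468369⟩ : WeierstrassCurve ℚ).IsElliptic :=
  X11b.isElliptic_of_discOf_ne_zero 1 (-1) 1 (-24407) (-1468369) (by decide +kernel)

/-- **`1890r1 = [1, -1, 1, -24407, -1468369]` is globally minimal** (`|Δ| = 2⁶·3³·5³·7⁹`; Silverman's
`q¹² ∤ Δ` at every bad prime). [cite: SilvermanAEC2009, VII.1 Remark 1.1] -/
theorem isGloballyMinimal_1890r1 : (⟨1, -1, 1, -24407, -1468369⟩ : WeierstrassCurve ℚ).IsGloballyMinimal :=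
  X11b.isGloballyMinimal_of_krausCriterion_support 1 (-1) 1 (-24407) (-1468369)
    [(2, 1, 6), (3, 3, 3), (5, 1, 3), (7, 1, 9)]
    (by intro t ht; simp only [List.mem_cons, List.not_mem_nil, or_false] at ht; rcases ht with rfl | rfl | rfl | rfl <;> norm_num)
    (by decide +kernel) (by decide +kernel)

/-- **RECORD `1890r` — `MissingPPartAt W p` for EVERY prime `p` at EVERY globally minimal member of the
class of `1890r1 = [1, -1, 1, -24407, -1468369]`** (`N = 1890 = 2·3³·5·7`; Cremona: class `1890r` = {1890r1
`#tors = 3`, `#Ш_an = 1`; 1890r2 `#tors = 1`, `#Ш_an = 9`; 1890r3 `#tors = 9`, `#Ш_an = 1`}, all `r_an = 0`;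
X3 ∧ O6). From bsd.S31 (`N < 5000`) + Cassels + GZK + modularity via §1; binders `hr`, `hN`, `hiso`. In
particular the UPPER half at `3` on every row of `stub_red_nineTorsionMember` in this class, and
`ord₃ #Ш(1890r2) = 2` exactly. Per class; nothing booked. [cite: CreutzMiller2012, Thm 1.1]
[cite: Miller2011LMS, §1 and Def. 1.1] [cite: Cremona2006, Table 1 (Cremona label 1890r1)] -/
theorem missingPPart_class1890r (hS31 : bsdTriple_of_rank_le_one_of_conductor_lt)
    (hCassels : bsdRHS_eq_of_isIsogenous) (hGZK : rank_eq_analyticRank_of_analyticRank_le_one)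
    (hmod : hasEntireLFunction_rat) (W₀ : WeierstrassCurve ℚ) (hW₀ : W₀ = ⟨1, -1, 1, -24407, -1468369⟩)
    (hr : W₀.analyticRank = 0) (hN : W₀.conductorNorm ℤ < 5000) (p : ℕ) [Fact p.Prime]
    (W : WeierstrassCurve ℚ) [W.IsElliptic] [W.IsGloballyMinimal] (hiso : IsIsogenous W W₀) :
    MissingPPartAt W p := by
  subst hW₀
  haveI := isElliptic_1890r1
  haveI := isGloballyMinimal_1890r1
  exact missingPPartAt_of_isIsogenous_of_conductor_lt hS31 hCassels hGZK hmod _ (by rw [hr]; exact zero_le_one)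
    hN p W hiso

/-- `Δ(122094bl1) = 7517215799675991166464 ≠ 0`: Cremona's model `122094bl1 = [1, -1, 1, -5862644, -3527169193]`
is an elliptic curve. [folklore] -/
theorem isElliptic_122094bl1 : (⟨1, -1, 1, -5862644, -3527169193⟩ : WeierstrassCurve ℚ).IsElliptic :=
  X11b.isElliptic_of_discOf_ne_zero 1 (-1) 1 (-5862644) (-3527169193) (by decide +kernel)

/-- **`122094bl1 = [1, -1, 1, -5862644, -3527169193]` is globally minimal** (`|Δ| = 2⁹·3³·7³·17³·19⁹`;
Silverman's `q¹² ∤ Δ` at every bad prime). [cite: SilvermanAEC2009, VII.1 Remark 1.1] -/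
theorem isGloballyMinimal_122094bl1 :
    (⟨1, -1, 1, -5862644, -3527169193⟩ : WeierstrassCurve ℚ).IsGloballyMinimal :=
  X11b.isGloballyMinimal_of_krausCriterion_support 1 (-1) 1 (-5862644) (-3527169193)
    [(2, 1, 9), (3, 3, 3), (7, 1, 3), (17, 1, 3), (19, 1, 9)]
    (by intro t ht; simp only [List.mem_cons, List.not_mem_nil, or_false] at ht; rcases ht with rfl | rfl | rfl | rfl | rfl <;> norm_num)
    (by decide +kernel) (by decide +kernel)

/-- **RECORD `122094bl` — `MissingPPartAt W 3` (both halves of BSD₃'s `Ш`-clause) at EVERY globally minimal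
member of the class of `122094bl1 = [1, -1, 1, -5862644, -3527169193]`** (`N = 122094 = 2·3³·7·17·19 > 5000`,
so bsd.S31 does not apply; Cremona: class `122094bl` = {122094bl1 `#tors = 3`, `#Ш_an = 1`; 122094bl2
`#tors = 1`, `#Ш_an = 9`; 122094bl3 `#tors = 9`, `#Ш_an = 1`}, all `r_an = 0`; X3 ∧ O6). From Cassels + GZK +
modularity via §1 with binders `hr` (`r_an = 0`), `hs` (`#Ш_an(122094bl1) = 1`, Cremona `allbsd`) and the
CERTIFICATE `hSha : #Ш(122094bl1)[3^∞] = 1` — EVIDENCE: kit j256899 (item evidence on 19190; engine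
`iso3kum.gp` sha256 a8402cb1…, b2b-bsdres-sha-2 ENGINE 2 UNMODIFIED; `bnfcertify = 1`, all local images to
exact Schaefer–Stoll size) row `122094bl1`, `3`-isogeny `x₀ = -2862`, `d = -3` (to 122094bl3): `dim Sel^{φ̂}(Ê)
= 0`, `dim Sel^{φ}(E) = 1`, `m = 1`, EXCESS `= 0 ⟹ Ш(E)[3] = 0` (`⟺ #Ш(E)[3^∞] = 1`). Hence also
`ord₃ #Ш(122094bl2) = 2` exactly. Per class; nothing booked. [cite: Miller2011LMS, §1 and Def. 1.1]
[cite: Cassels1965ArithmeticVIII] [cite: SchaeferStoll2004] [cite: Cremona2006, Table 1 (Cremona label 122094bl1)] -/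
theorem missingPPart3_class122094bl (hCassels : bsdRHS_eq_of_isIsogenous)
    (hGZK : rank_eq_analyticRank_of_analyticRank_le_one) (hmod : hasEntireLFunction_rat)
    (W₀ : WeierstrassCurve ℚ) (hW₀ : W₀ = ⟨1, -1, 1, -5862644, -3527169193⟩) (hr : W₀.analyticRank = 0)
    (hs : shaAn W₀ = ((1 : ℚ) : ℂ)) (hSha : Nat.card (AddCommGroup.primaryComponent W₀.sha 3) = 1)
    (W : WeierstrassCurve ℚ) [W.IsElliptic] [W.IsGloballyMinimal] (hiso : IsIsogenous W W₀) :
    MissingPPartAt W 3 := by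
  subst hW₀
  haveI := isElliptic_122094bl1
  haveI := isGloballyMinimal_122094bl1
  haveI : Fact (Nat.Prime 3) := ⟨Nat.prime_three⟩
  exact missingPPartAt_of_isIsogenous_of_card_primaryComponent_eq_one hCassels hGZK hmod _
    (by rw [hr]; exact zero_le_one) 3 hs (by simp) hSha W hiso

/-! ## §3 `stub_red_nineTorsionMember` BY NAME on its census classes -/

/-- **`Sig.stub_red_nineTorsionMember` RESTRICTED TO ITS CENSUS CLASSES** (the registered stub of item 19190,
hypotheses and conclusion VERBATIM, plus ONE extra hypothesis `hcls`: the row is `ℚ`-isogenous to `54b1`,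
`1890r1` or `122094bl1` — which IS the census statement «for `N < 5·10⁵` the X3 ∧ O6 ∧ r0 classes with a
`ℤ/9` member are exactly `54b`, `1890r`, `122094bl`», o6-r1 GEN 21 C-X3K-0). Below bsd.S31 (`hS31`), Cassels
(`hCassels`), GZK (`hGZK`), modularity (`hmod`) and the §2 per-class binders (`h54`, `h1890`: `r_an = 0` and
`N < 5000` at the literal models; `h122094`: `r_an = 0`, `#Ш_an = 1` and the `3`-descent certificate
`#Ш[3^∞] = 1` at `122094bl1`). The stub's own hypotheses (`r_an(W) = 0`, `ClassO6 W 3`, reducibility, the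
`ℤ/9` member) are not used: the records give the upper half on the whole class. HONEST LABEL: census-level
only — class-wide (beyond `N < 5·10⁵`) the stub is the count fact's road
(`WildUpperReducibleDefectStubs.stub_red_nineTorsionMember_of_routeInputs`); no count fact and no crux M is
used here; the item is NOT closed by this. [cite: CreutzMiller2012, Thm 1.1] [cite: Miller2011LMS, §1 and Def. 1.1]
[cite: Cassels1965ArithmeticVIII] [cite: Cremona2006, Table 1] -/
theorem stub_red_nineTorsionMember_onCensusClasses (hS31 : bsdTriple_of_rank_le_one_of_conductor_lt)
    (hCassels : bsdRHS_eq_of_isIsogenous) (hGZK : rank_eq_analyticRank_of_analyticRank_le_one)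
    (hmod : hasEntireLFunction_rat)
    (h54 : (⟨1, -1, 1, 1, -1⟩ : WeierstrassCurve ℚ).analyticRank = 0 ∧
      (⟨1, -1, 1, 1, -1⟩ : WeierstrassCurve ℚ).conductorNorm ℤ < 5000)
    (h1890 : (⟨1, -1, 1, -24407, -1468369⟩ : WeierstrassCurve ℚ).analyticRank = 0 ∧
      (⟨1, -1, 1, -24407, -1468369⟩ : WeierstrassCurve ℚ).conductorNorm ℤ < 5000)
    (h122094 : (⟨1, -1, 1, -5862644, -3527169193⟩ : WeierstrassCurve ℚ).analyticRank = 0 ∧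
      shaAn (⟨1, -1, 1, -5862644, -3527169193⟩ : WeierstrassCurve ℚ) = ((1 : ℚ) : ℂ) ∧
      Nat.card (AddCommGroup.primaryComponent
        (⟨1, -1, 1, -5862644, -3527169193⟩ : WeierstrassCurve ℚ).sha 3) = 1) :
    ∀ (W : WeierstrassCurve ℚ) [W.IsElliptic] [W.IsGloballyMinimal] [Fact (3 : ℕ).Prime],
      W.analyticRank = 0 → ClassO6 W 3 → ¬ W.HasIrreducibleModPGaloisRep 3 →
      (∃ (W' : WeierstrassCurve ℚ) (_ : W'.IsElliptic), IsIsogenous W W' ∧ 3 ^ 2 ∣ W'.torsionOrder) →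
      (IsIsogenous W (⟨1, -1, 1, 1, -1⟩ : WeierstrassCurve ℚ) ∨
        IsIsogenous W (⟨1, -1, 1, -24407, -1468369⟩ : WeierstrassCurve ℚ) ∨
        IsIsogenous W (⟨1, -1, 1, -5862644, -3527169193⟩ : WeierstrassCurve ℚ)) →
        MissingUpperBoundAt W 3 := by
  intro W _ _ _ _ _ _ _ hcls
  rcases hcls with h | h | h
  · exact (lower_and_upper_of_missingPPartAt W 3
      (missingPPart_class54b hS31 hCassels hGZK hmod _ rfl h54.1 h54.2 3 W h)).2
  · exact (lower_and_upper_of_missingPPartAt W 3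
      (missingPPart_class1890r hS31 hCassels hGZK hmod _ rfl h1890.1 h1890.2 3 W h)).2
  · exact (lower_and_upper_of_missingPPartAt W 3
      (missingPPart3_class122094bl hCassels hGZK hmod _ rfl h122094.1 h122094.2.1 h122094.2.2 W h)).2

end Summit.BirchSwinnertonDyer.BirchSwinnertonDyer.Theorems.WildUpperReducibleNineTorsionClasses

end
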